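import Literature.AnabelianGeometry.EtaleTheta.ThetaSettingHatTheta
import Literature.AnabelianGeometry.EtaleTheta.ThetaQuotientsOfCurveHat
import HarnessLib

/-!
# [EtTh] §1 p. 12 / Rmk. 1.6.4: the profinite theta quotient record `ThetaSetting.HatTheta` is INHABITED at every
# CURVE-BASED theta setting with compact `Δ_Θ` (the constructor `HatTheta.ofCurveTheta`)

S. Mochizuki, *The Étale Theta Function …* [EtTh], Publ. RIMS **45** (2009), §1, PDF p. 12 (PRIMS p. 238): "Write
`Π_X = (Π^tp_X)^∧`"; "`Δ^Θ_X = Δ_X/[Δ_X,[Δ_X,Δ_X]]`"; "`(Ẑ(1) ≅) Δ_Θ ⊆ Δ^Θ_X`" [cite: MochizukiEtTh2009, §1 p.12];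
Remark 1.6.4, PDF p. 26 (PRIMS p. 252): "there are [easier] profinite versions of the constructions given in the
present §1" [cite: MochizukiEtTh2009, Rmk 1.6.4 p.26].

Layer L2 of the abc-iut cell, seat abc-iut-f-142 gen 8, row «HATTHETA-OF-CURVE» (abc-iut-L2-lead gen 8 R1273 GO),
file B (class (b) CONSTRUCTION; file A = `ThetaQuotientsOfCurveHat.lean`).  abc-iut-f-142's record
`ThetaSetting.HatTheta D` (`ThetaSettingHatTheta.lean`, p504464) is a HYPOTHESIS record asserted for no datum.  Here:

* `ThetaSetting.HatTheta.ofCurveTheta D e he hΔ : D.HatTheta` — for a theta setting `D` whose tempered theta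
  quotient IS abc-iut-L2-d1's canonical one up to an isomorphism of topological groups
  `e : D.GtpTheta ≃ₜ* CurveTheta.GTheta D.toTemperedCurve` over `Π^tp_X` (`he : e ∘ D.toTheta = CurveTheta.toTheta`;
  at the cell's curve-based models `GtpTheta := CurveTheta.GTheta _`, so `e := ContinuousMulEquiv.refl _`, `he := rfl`)
  and whose `Δ_Θ` is COMPACT (`hΔ`; print's "`(Ẑ(1) ≅) Δ_Θ`"): `GhatTheta := Π_X ⧸ [[Δ_X,Δ_X],Δ_X]⁻`,
  `toThetaHat :=` the quotient map, `ι := ιTheta ∘ e` — a profinite completion by file A's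
  `isProfiniteCompletion_ιTheta` transported along `e` — the square by `rfl` + `he`, and `ι(Δ_Θ)` closed as the
  continuous image of a compact set in a Hausdorff group;
* so the ONLY displayed binder of the inhabitant is «`Δ_Θ` compact» — TRUE in print (`Ẑ(1)`) and wherever a model's
  `Δ`-part is profinite, FALSE at the cell's discrete-`F₂` models (where `Δ_Θ ≅ ℤ` is discrete) — HONEST LABEL: this
  file inhabits the record at no SPECIFIC datum; the one-line instances at modelχ′ / modelχq / curveLat are their
  owners' (they discharge `hΔ`).

No notation, no `Prop`-fact, no instance; nothing of [EtTh] is asserted; no side is taken on [IUTchIII] Cor. 3.12;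
nothing here asserts that abc is proved or refuted; typed ≠ inhabited ≠ proved.
-/

noncomputable section

namespace Literature.AnabelianGeometry.EtaleTheta

open Topology
open Literature.AnabelianGeometry.SemiGraphs

variable {p : ℕ} [Fact p.Prime]

namespace ThetaSetting

namespace HatTheta

/-- Transport of abc-iut-L3's `IsProfiniteCompletion` along an isomorphism of topological groups of the SOURCE:
`ι : F → F̂` a profinite completion and `e : F′ ≃ₜ* F` ⇒ `ι ∘ e` is a profinite completion of `F′` (all clauses move
through `e`; cf. abc-iut-w5-d139's `isProfiniteCompletion_comp_continuousMulEquiv` in the L6 file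
`ThetaSettingDeltaCompletionMapProfinite`, re-proved here privately to keep the L2 import graph acyclic). [folklore] -/
private theorem isProfiniteCompletion_comp_equiv {F F' Fhat : Type*} [Group F] [TopologicalSpace F]
    [Group F'] [TopologicalSpace F'] [Group Fhat] [TopologicalSpace Fhat] {ι : F →ₜ* Fhat}
    (hι : IsProfiniteCompletion ι) (e : F' ≃ₜ* F) :
    IsProfiniteCompletion (ι.comp (e : F' →ₜ* F)) := by
  refine ⟨hι.compactSpace, hι.t2Space, hι.totallyDisconnectedSpace, ?_, ?_, ?_⟩
  · -- dense range: `e` is surjective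
    have hr : Set.range (ι.comp (e : F' →ₜ* F)) = Set.range ι := by
      ext z
      constructor
      · rintro ⟨x, rfl⟩; exact ⟨e x, rfl⟩
      · rintro ⟨x, rfl⟩; exact ⟨e.symm x, by change ι (e (e.symm x)) = ι x; rw [e.apply_symm_apply]⟩
    change Dense (Set.range _)
    rw [hr]; exact hι.denseRange
  · -- open normal finite-index subgroups of `F'` are `e⁻¹` of those of `F`
    intro U hU
    haveI := hU
    let U₁ : OpenNormalSubgroup F :=
      ⟨⟨U.toSubgroup.comap (e.symm : F →ₜ* F').toMonoidHom,
        U.toOpenSubgroup.isOpen.preimage e.symm.continuous⟩,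
        Subgroup.Normal.comap inferInstance _⟩
    have hU₁ : U₁.toSubgroup.FiniteIndex := by
      change (U.toSubgroup.comap (e.symm : F →ₜ* F').toMonoidHom).FiniteIndex
      rw [Subgroup.finiteIndex_iff, Subgroup.index_comap_of_surjective _ e.symm.surjective]
      exact hU.index_ne_zero
    obtain ⟨V, hV⟩ := hι.comap_surjective U₁ hU₁
    refine ⟨V, ?_⟩
    ext x
    have h1 : e x ∈ U₁.toSubgroup ↔ e x ∈ V.toSubgroup.comap ι.toMonoidHom := by rw [hV]
    have h2 : e x ∈ U₁.toSubgroup ↔ x ∈ U.toSubgroup := by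
      change e.symm (e x) ∈ U.toSubgroup ↔ _
      rw [e.symm_apply_apply]
    rw [← h2, h1]
    rfl
  · intro V
    exact V.toOpenSubgroup.isOpen.preimage (ι.comp (e : F' →ₜ* F)).continuous

/-- **The inhabitant of `ThetaSetting.HatTheta` at a curve-based theta setting with compact `Δ_Θ`** ([EtTh] §1 p. 12:
`Π_X = (Π^tp_X)^∧`, `Δ^Θ_X = Δ_X/[Δ_X,[Δ_X,Δ_X]]`, `(Ẑ(1) ≅) Δ_Θ`): given an identification `e` of `D`'s tempered theta
quotient with abc-iut-L2-d1's canonical `Π^tp_X ⧸ toHat⁻¹([[Δ_X,Δ_X],Δ_X]⁻)` over `Π^tp_X` and the compactness of `Δ_Θ`,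
the profinite theta quotient `Π_X ⧸ [[Δ_X,Δ_X],Δ_X]⁻` of file A with `ι := ιTheta ∘ e` fills every field of the record
(kernel and square by construction, `ι` a profinite completion by `isProfiniteCompletion_ιTheta`, `ι(Δ_Θ)` closed as a
compact subset of a Hausdorff group). [cite: MochizukiEtTh2009, §1 p.12] -/
def ofCurveTheta (D : ThetaSetting p) (e : D.GtpTheta ≃ₜ* CurveTheta.GTheta D.toTemperedCurve)
    (he : ∀ g : D.PiTemp, e (D.toTheta g) = CurveTheta.toTheta D.toTemperedCurve g)
    (hΔ : IsCompact (D.DeltaTheta : Set D.GtpTheta)) : D.HatTheta where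
  GhatTheta := CurveTheta.GThetaHat D.toTemperedCurve
  toThetaHat := CurveTheta.toThetaHat D.toTemperedCurve
  ker_toThetaHat := CurveTheta.ker_toThetaHat D.toTemperedCurve
  ι := (CurveTheta.ιTheta D.toTemperedCurve).comp (e : D.GtpTheta →ₜ* CurveTheta.GTheta D.toTemperedCurve)
  isProfiniteCompletion_ι :=
    isProfiniteCompletion_comp_equiv (CurveTheta.isProfiniteCompletion_ιTheta D.toTemperedCurve) e
  ι_toTheta g := by
    change CurveTheta.ιTheta D.toTemperedCurve (e (D.toTheta g)) = _
    rw [he]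
    exact CurveTheta.ιTheta_toTheta D.toTemperedCurve g
  isClosed_map_deltaTheta := by
    haveI : T2Space (CurveTheta.GThetaHat D.toTemperedCurve) :=
      (CurveTheta.isProfiniteCompletion_ιTheta D.toTemperedCurve).t2Space
    have hc : IsCompact ((CurveTheta.ιTheta D.toTemperedCurve).comp
        (e : D.GtpTheta →ₜ* CurveTheta.GTheta D.toTemperedCurve) '' (D.DeltaTheta : Set D.GtpTheta)) :=
      hΔ.image ((CurveTheta.ιTheta D.toTemperedCurve).comp
        (e : D.GtpTheta →ₜ* CurveTheta.GTheta D.toTemperedCurve)).continuous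
    rw [Subgroup.coe_map]
    exact hc.isClosed

/-- The constructor's profinite theta quotient IS file A's `Π_X ⧸ [[Δ_X,Δ_X],Δ_X]⁻` (by `rfl`).
[cite: MochizukiEtTh2009, §1 p.12] -/
theorem ofCurveTheta_ghatTheta (D : ThetaSetting p) (e : D.GtpTheta ≃ₜ* CurveTheta.GTheta D.toTemperedCurve)
    (he : ∀ g : D.PiTemp, e (D.toTheta g) = CurveTheta.toTheta D.toTemperedCurve g)
    (hΔ : IsCompact (D.DeltaTheta : Set D.GtpTheta)) :
    (ofCurveTheta D e he hΔ).GhatTheta = CurveTheta.GThetaHat D.toTemperedCurve := rfl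

/-- The constructor's `ι` is `ιTheta ∘ e` (pointwise). [cite: MochizukiEtTh2009, §1 p.12] -/
theorem ofCurveTheta_ι_apply (D : ThetaSetting p) (e : D.GtpTheta ≃ₜ* CurveTheta.GTheta D.toTemperedCurve)
    (he : ∀ g : D.PiTemp, e (D.toTheta g) = CurveTheta.toTheta D.toTemperedCurve g)
    (hΔ : IsCompact (D.DeltaTheta : Set D.GtpTheta)) (x : D.GtpTheta) :
    (ofCurveTheta D e he hΔ).ι x = CurveTheta.ιTheta D.toTemperedCurve (e x) := rfl

/-- **Non-vacuity shape of the record:** every theta setting whose tempered theta quotient is the canonical one (up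
to `e` over `Π^tp_X`) and whose `Δ_Θ` is compact CARRIES a profinite theta quotient record — `Nonempty D.HatTheta`.
[cite: MochizukiEtTh2009, Rmk 1.6.4 p.26] -/
theorem nonempty_of_curveTheta (D : ThetaSetting p) (e : D.GtpTheta ≃ₜ* CurveTheta.GTheta D.toTemperedCurve)
    (he : ∀ g : D.PiTemp, e (D.toTheta g) = CurveTheta.toTheta D.toTemperedCurve g)
    (hΔ : IsCompact (D.DeltaTheta : Set D.GtpTheta)) : Nonempty D.HatTheta :=
  ⟨ofCurveTheta D e he hΔ⟩

end HatTheta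

end ThetaSetting

end Literature.AnabelianGeometry.EtaleTheta

end
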